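import Literature.MathematicalPhysics.QuantumFieldTheory.SU2HighTemperatureNonConfinementHolds
import HarnessLib

/-!
# Tomboulis–Yaffe 1985 at every temporal extent and every even spatial box; Polyakov long-range
# order for `SU(2)` in every `d ≥ 2`

Theorems I and II of [TomboulisYaffe1985] are vendored (`SU2HighTemperatureNonConfinement.lean`, facts
`PolyakovTwoPointLowerBound`, `MagneticFluxFreeEnergyBound`) and proved (`SU2HighTemperatureNonConfinementHolds.lean`)
exactly as printed: temporal extent `L_t = 2^a`, spatial side `L_s = 2^k` ("For technical convenience we will assume
that the lattice lengths in 'time' (`L_t`) and 'space' (`L_s`) are integer powers of two", p. 314), couplings on the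
physical hyperbola `(J_E, J_M) = (γθ, γ/θ)`.  Every per-box lemma of the tree's proof chain is, however, already stated
for an ARBITRARY temporal extent `L₀ ≥ 1` and an arbitrary EVEN spatial side `L_s = 2n + 2 ≥ 4`:

* the Peierls reduction `polyakovCorrelation_ge_of_disorderBounds` (`L_s ≥ 3`) and the vortex bound
  `magneticFluxExp_le_of_disorderBounds` (`L_s = 2n+2 ≥ 4`) of `SU2HighTemperaturePeierlsReduction.lean`;
* the chessboard reductions `expectation_pointDefect_le_of_patternBound`, `expectation_wallEvent_le_of_patternBound`
  (`L_s = 2n+2`; the abstract chessboard estimate `chessboard_le_rpow_even` holds on every EVEN torus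
  [cite: FrohlichIsraelLiebSimon1978, Thm 4.1]) and the magnetic-coupling removal
  `expectation_le_exp_mul_expectation_electric` of `FiniteTemperaturePolyakovChessboard.lean`;
* the electric pattern bounds `expectation_pointDefect_le`, `expectation_axisWall_le` of `SU2ElectricPatternBounds.lean`
  (any `L₀`: the time direction is decimated by `L₀ − 1` one-step Jensen merges, `transferKernel_le_pairKernel`, instead of
  the `log₂ L_t` doublings of TY's App. III).

Only the four top-level assemblies specialise to `2^a`, `2^k`.  This file re-assembles the same lemmas without that
specialisation (no new estimate is proved here) and records the consequences in the vocabulary of the barrier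
`Literature.Barriers.QuantumFields.FiniteTemperatureDeconfinement`:

1. `electricPatternBounds_allExtents`, `disorderBounds_allExtents` — TY (3.9)–(3.26) for every `L₀ ≥ 1`, every even
   `L_s ≥ 4`, in REGION form: for every `M ≥ 0` there are `J₁(d, L₀, M)` and a rate `K(J_E) → 0` such that the disorder
   bounds (3.25)–(3.26) hold for all `J_E > J₁` and all `0 ≤ J_M ≤ M` (the tail of every hyperbola `(γθ, γ/θ)`, `θ ≥ 1`,
   lies in the region `M = γ`);
2. `polyakovCorrelation_ge_allExtents` (Theorem I: `G_L(x) ≥ 4e^{−μ(J_E)}`, `μ → 0`) and `magneticFluxExp_le_half_allExtents`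
   (Theorem II: `exp(−F^{mag}_{0i}/T) ≤ ½` for every stack direction `i`), region form, plus the printed hyperbola forms
   `…_hyperbola` at every `L₀` and every even `L_s ≥ 4`;
3. ★ `hasPolyakovLongRangeOrder_su2` / `…_hyperbola`: the barrier's POSITIVE notion
   `FiniteTemperature.HasPolyakovLongRangeOrder d L₀ (fundamentalRep (Fin 2)) J_E J_M` — EVERY subsequential
   thermodynamic limit of the Polyakov two-point function along even boxes is bounded below by `4e^{−μ} > 0` — for
   `SU(2)` in EVERY `d ≥ 2` at EVERY temporal extent `L₀ ≥ 1`, for `J_E > J₁(d, L₀, M)`, `0 ≤ J_M ≤ M`.  The tree's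
   Borgs–Seiler theorem `FiniteTemperatureDeconfinement_holds` gives long-range order for `U(N)`/`SU(N)` only in
   `d ≥ 3` (the infrared bound needs `∫ d^dp / E(p) < ∞`); in `d = 2` space dimensions (`2+1`-dimensional `SU(2)`
   lattice gauge theory at finite temperature) this is the Peierls/chessboard route of Tomboulis–Yaffe, and Theorem I
   on the boxes `2^k` alone does not give it (`SU2HighTemperatureNonConfinement` §4);
4. `su2_not_polyakovConfinementAtAllCouplings`, `su2_not_uniformClusteringAtAllCouplings`: the technique classes (i),
   (ii) of the barrier fail for `SU(2)` in every `d ≥ 2` at EVERY temporal extent `L₀ ≥ 1` (the tree had `L₀ = 2^a`: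
   `not_…_su2_holds`).

Scope and honesty.  Finite-temperature LATTICE statements (fixed `L₀`, spatial thermodynamic limit).  No claim is made
for the isotropic Wilson action `J_E = J_M = β → ∞` (removing the magnetic coupling costs a factor `e^{O(J_M)}` per
spatial site, which the electric rate `K(J_E) ≍ J_E^{−1/2d}` beats only for bounded `J_M`); Borgs–Seiler's isotropic
statement (`FiniteTemperatureDeconfinement.isotropic_…`) remains the only isotropic one in the tree and needs `d ≥ 3`.
Relative to print the only extension is dropping "powers of two" (a convenience in the paper, p. 314) — obtained here as
a THEOREM from the landed lemmas, not vendored as a fact.  Nothing in this file bears on the zero-temperature mass gap.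

## References

* E. T. Tomboulis, L. G. Yaffe, *Finite temperature SU(2) lattice gauge theory*, Commun. Math. Phys. 100 (1985)
  313–341: lattice conventions p. 314; Theorems I–II p. 320 and their corollary forms p. 321; §III.A–C (3.1)–(3.26)
  pp. 321–325; App. II–IV pp. 333–340. [TomboulisYaffe1985]
* C. Borgs, E. Seiler, *Lattice Yang–Mills theory at nonzero temperature and the confinement problem*, Commun. Math.
  Phys. 91 (1983) 329–380: §II.3 (II.23) (long-range order "clearly means absence of confinement"), p. 337.
  [BorgsSeiler1983]
* J. Fröhlich, R. Israel, E. H. Lieb, B. Simon, *Phase transitions and reflection positivity. I*, Commun. Math. Phys.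
  62 (1978) 1–34: Thm 4.1 (chessboard estimate). [FrohlichIsraelLiebSimon1978]
-/

open MeasureTheory Filter Topology Function
open Literature.MathematicalPhysics.QuantumLattice (fundamentalRep continuous_fundamentalRep
  fundamentalRep_mem_unitaryGroup)
open Literature.Barriers.QuantumFields Literature.Barriers.QuantumFields.FiniteTemperature

namespace Literature.MathematicalPhysics.QuantumFieldTheory.TomboulisYaffeHighTemperature

noncomputable section

/-! ### §1. The electric pattern bounds at every temporal extent and in every spatial box -/

section Electric

/-- **TY's electric pattern bounds (3.9)–(3.24) at `J_M = 0`, every temporal extent `L₀ ≥ 1`, every spatial box `L`**: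
for `d ≥ 2` there are `J₀(d, L₀)` and a rate `K(J) → 0` (`K ≥ 0`, `K ≍ J^{−1/2d}`) with
`⟨∏_x (1 − |½trΩ_x|)⟩_{J,0} ≤ K(J)^{L^d}` and, for each axis `i`, `⟨all bonds ⟨y, y+e_i⟩ are walls⟩_{J,0} ≤ K(J)^{d L^d}`
for all `J > J₀` and ALL `L ≥ 1`.  Same proof as `electricPatternBounds` (which is the case `L₀ = 2^a`, `L = 2^k`): the
per-box estimates `expectation_pointDefect_le` ∕ `expectation_axisWall_le` with `L₀ − 1` merge steps and the decay
`ratioPoint_le` ∕ `ratioWall_le`. [cite: TomboulisYaffe1985, §III.C (3.9)–(3.24), pp. 323–325; App. III.A (A3.1)–(A3.5), pp. 334–335] -/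
theorem electricPatternBounds_allExtents {d : ℕ} (hd : 2 ≤ d) (L₀ : ℕ) [NeZero L₀] :
    ∃ J₀ : ℝ, ∃ K : ℝ → ℝ, Tendsto K atTop (𝓝 0) ∧ (∀ J, 0 ≤ K J) ∧
      ∀ J : ℝ, J₀ < J → ∀ (L : ℕ) [NeZero L],
        expectation (d := d) (L₀ := L₀) (L := L) (fundamentalRep (Fin 2)) J 0
            (fun U => ∏ x, (1 - |halfTrace U x|)) ≤ K J ^ L ^ d ∧
        ∀ i : Fin d, expectation (d := d) (L₀ := L₀) (L := L) (fundamentalRep (Fin 2)) J 0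
            ((wallEvent ((Finset.univ : Finset (Fin d → ZMod L)) ×ˢ {i})).indicator 1) ≤
          K J ^ (d * L ^ d) := by
  obtain ⟨m, rfl⟩ : ∃ m, d = m + 2 := ⟨d - 2, by omega⟩
  set n : ℕ := L₀ - 1 with hn
  -- the decay constants (as in `electricPatternBounds`)
  set A₁ : ℝ := ((4 : ℝ) ^ n) ^ 2 / (8 * (8 / (3 * Real.pi ^ 3)) * kernelRatioConst n ^ (m + 2)) with hA₁
  set A₂ : ℝ := 2 ^ (m + 2) * ((4 : ℝ) ^ n) ^ 2 / (16 * (8 / (3 * Real.pi ^ 3)) * kernelRatioConst n ^ (m + 2)) +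
    2 * 4 ^ m * (m + 2).factorial * ((4 : ℝ) ^ n) ^ (m + 2) / ((8 / (3 * Real.pi ^ 3)) * kernelRatioConst n ^ (m + 2))
    with hA₂
  have hκ := kernelRatioConst_pos n
  have hd0 : (m + 2 : ℕ) ≠ 0 := by omega
  have hdinv : 0 < ((m + 2 : ℕ) : ℝ)⁻¹ := by positivity
  refine ⟨max 16 ((4 : ℝ) ^ n), fun J => max (ratioPoint m n J) (ratioWall m n J ^ ((m + 2 : ℕ) : ℝ)⁻¹), ?_,
    fun J => le_max_of_le_left (ratioPoint_nonneg m n J), ?_⟩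
  · -- `K(J) → 0`: squeeze between `0` and `max(A₁ J^{-1/2}, (A₂ J^{-1/2})^{1/d})`
    have hsq : Tendsto (fun J : ℝ => (Real.sqrt J)⁻¹) atTop (𝓝 0) :=
      tendsto_inv_atTop_zero.comp Real.tendsto_sqrt_atTop
    have hg : Tendsto (fun J : ℝ => max (A₁ * (Real.sqrt J)⁻¹) ((A₂ * (Real.sqrt J)⁻¹) ^ ((m + 2 : ℕ) : ℝ)⁻¹))
        atTop (𝓝 0) := by
      have h1 : Tendsto (fun J : ℝ => A₁ * (Real.sqrt J)⁻¹) atTop (𝓝 0) := by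
        simpa using hsq.const_mul A₁
      have h2 : Tendsto (fun J : ℝ => (A₂ * (Real.sqrt J)⁻¹) ^ ((m + 2 : ℕ) : ℝ)⁻¹) atTop (𝓝 0) := by
        have h2' : Tendsto (fun J : ℝ => A₂ * (Real.sqrt J)⁻¹) atTop (𝓝 0) := by simpa using hsq.const_mul A₂
        have hc : Tendsto (fun x : ℝ => x ^ ((m + 2 : ℕ) : ℝ)⁻¹) (𝓝 0) (𝓝 0) := by
          have h := (Real.continuous_rpow_const hdinv.le).tendsto 0
          rwa [Real.zero_rpow hdinv.ne'] at h
        exact hc.comp h2'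
      simpa using h1.max h2
    refine tendsto_of_tendsto_of_tendsto_of_le_of_le' tendsto_const_nhds hg ?_ ?_
    · exact Eventually.of_forall fun J => le_max_of_le_left (ratioPoint_nonneg m n J)
    · filter_upwards [eventually_ge_atTop (max 16 ((4 : ℝ) ^ n))] with J hJ
      have hJ16 : 16 ≤ J := le_trans (le_max_left _ _) hJ
      have hJn : (4 : ℝ) ^ n ≤ J := le_trans (le_max_right _ _) hJ
      exact max_le_max (ratioPoint_le hJ16)
        (Real.rpow_le_rpow (ratioWall_nonneg m n (by linarith)) (ratioWall_le hJ16 hJn) hdinv.le)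
  · intro J hJ L _
    have hJ16 : 16 ≤ J := le_trans (le_max_left _ _) hJ.le
    have hJn : (4 : ℝ) ^ n ≤ J := le_trans (le_max_right _ _) hJ.le
    have hJ1 : (1 : ℝ) ≤ J := by linarith
    have hb : 1 / 2 ≤ bSeq J (L₀ - 1) := by
      have h1 := bSeq_ge J hJ16 n
      have h2 : (2 : ℝ) ≤ 2 * J / 4 ^ n := by rw [le_div_iff₀ (by positivity)]; linarith
      rw [← hn]; linarith
    have hcard : Fintype.card (Fin (m + 2) → ZMod L) = L ^ (m + 2) := by
      rw [Fintype.card_fun, ZMod.card, Fintype.card_fin]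
    refine ⟨?_, fun i => ?_⟩
    · calc expectation (d := m + 2) (L₀ := L₀) (L := L) (fundamentalRep (Fin 2)) J 0
            (fun U => ∏ x, (1 - |halfTrace U x|))
          ≤ ratioPoint m (L₀ - 1) J ^ Fintype.card (Fin (m + 2) → ZMod L) := expectation_pointDefect_le hJ1 hb
        _ ≤ (max (ratioPoint m n J) (ratioWall m n J ^ ((m + 2 : ℕ) : ℝ)⁻¹)) ^ L ^ (m + 2) := by
            rw [hcard]
            exact pow_le_pow_left₀ (ratioPoint_nonneg m n J) (le_max_left _ _) _
    · calc expectation (d := m + 2) (L₀ := L₀) (L := L) (fundamentalRep (Fin 2)) J 0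
            ((wallEvent ((Finset.univ : Finset (Fin (m + 2) → ZMod L)) ×ˢ {i})).indicator 1)
          ≤ ratioWall m (L₀ - 1) J ^ Fintype.card (Fin (m + 2) → ZMod L) := expectation_axisWall_le hJ1 hb i
        _ = ((ratioWall m n J ^ ((m + 2 : ℕ) : ℝ)⁻¹) ^ (m + 2)) ^ L ^ (m + 2) := by
            rw [hcard, Real.rpow_inv_natCast_pow (ratioWall_nonneg m n (by linarith)) hd0]
        _ ≤ ((max (ratioPoint m n J) (ratioWall m n J ^ ((m + 2 : ℕ) : ℝ)⁻¹)) ^ (m + 2)) ^ L ^ (m + 2) :=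
            pow_le_pow_left₀ (pow_nonneg (Real.rpow_nonneg (ratioWall_nonneg m n (by linarith)) _) _)
              (pow_le_pow_left₀ (Real.rpow_nonneg (ratioWall_nonneg m n (by linarith)) _) (le_max_right _ _) _) _
        _ = (max (ratioPoint m n J) (ratioWall m n J ^ ((m + 2 : ℕ) : ℝ)⁻¹)) ^ ((m + 2) * L ^ (m + 2)) := by
            rw [← pow_mul]

end Electric

/-! ### §2. Tomboulis–Yaffe's disorder bounds (3.25)–(3.26) in the region `J_E > J₁(d, L₀, M)`, `0 ≤ J_M ≤ M` -/

section Disorder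

variable {d L₀ L : ℕ} [NeZero L₀] [NeZero L]

omit [NeZero L₀] [NeZero L] in
/-- The half-trace of the Polyakov loop depends continuously on the configuration. [folklore] -/
private theorem continuous_halfTrace₀ (y : Fin d → ZMod L) :
    Continuous fun U : Config d L₀ L SU2 => halfTrace U y :=
  (Complex.continuous_re.comp (continuous_polyakovTrace (fundamentalRep (Fin 2))
    (continuous_fundamentalRep (Fin 2)) y)).div_const 2

/-- The domain-wall event of a finite bond set is measurable. [folklore] -/
private theorem measurableSet_wallEvent₀ (B : Finset ((Fin d → ZMod L) × Fin d)) :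
    MeasurableSet (wallEvent (d := d) (L₀ := L₀) (L := L) B) := by
  have hhem : ∀ y : Fin d → ZMod L, MeasurableSet {U : Config d L₀ L SU2 | 0 ≤ halfTrace U y} := fun y =>
    (isClosed_le continuous_const (continuous_halfTrace₀ y)).measurableSet
  have hwall : ∀ y y' : Fin d → ZMod L,
      MeasurableSet {U : Config d L₀ L SU2 | ¬ (0 ≤ halfTrace U y ↔ 0 ≤ halfTrace U y')} := by
    intro y y'
    have h : {U : Config d L₀ L SU2 | ¬ (0 ≤ halfTrace U y ↔ 0 ≤ halfTrace U y')} =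
        symmDiff {U | 0 ≤ halfTrace U y} {U | 0 ≤ halfTrace U y'} := by
      ext U
      simp only [Set.mem_setOf_eq, Set.mem_symmDiff]
      tauto
    rw [h]
    exact (hhem y).symmDiff (hhem y')
  have h : wallEvent (d := d) (L₀ := L₀) (L := L) B =
      ⋂ b ∈ B, {U | ¬ (0 ≤ halfTrace U b.1 ↔ 0 ≤ halfTrace U (b.1 + Pi.single b.2 1))} := by
    ext U; simp [wallEvent]
  rw [h]
  exact Finset.measurableSet_biInter B fun b _ => hwall _ _

/-- The number of sites of the lattice `ℤ_{L₀} × (ℤ/L)^d`. [folklore] -/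
private theorem card_site₀ (d L₀ L : ℕ) [NeZero L₀] [NeZero L] :
    Fintype.card (FiniteTemperature.Site d L₀ L) = L₀ * L ^ d := by
  simp [FiniteTemperature.Site, Fintype.card_prod, ZMod.card, Fintype.card_pi]

omit [NeZero L] in
/-- ★★ **Tomboulis–Yaffe's disorder bounds (3.25)–(3.26) at every temporal extent `L₀ ≥ 1`, in every EVEN spatial box
`L_s = 2n + 2 ≥ 4`, in the region `J_E > J₁(d, L₀, M)`, `0 ≤ J_M ≤ M`**: for `d ≥ 2` and `M ≥ 0` there are `J₁` and a
rate `K(J_E) → 0` (`K ≥ 0`) such that the point-defect probability obeys `⟨1 − |½trΩ[0]|⟩ ≤ K(J_E)` and every finite set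
`B` of spatial bonds carries domain walls with probability `≤ K(J_E)^{|B|}`, uniformly in `n ≥ 1`.  Proof: the electric
pattern bounds (`electricPatternBounds_allExtents`), the removal of the magnetic coupling at cost
`exp(4 J_M L₀ #{i<j} · L_s^d) ≤ (e^{4 M L₀ #{i<j}})^{L_s^d}` (`expectation_le_exp_mul_expectation_electric`), and the
chessboard roots `expectation_pointDefect_le_of_patternBound` ∕ `expectation_wallEvent_le_of_patternBound` on the even
torus. [cite: TomboulisYaffe1985, §III.B (3.5)–(3.6) (p. 322); §III.C (3.9)–(3.10), (3.23)–(3.26) (pp. 323–325); App. III.A (p. 334)] -/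
theorem disorderBounds_allExtents (hd : 2 ≤ d) (L₀ : ℕ) [NeZero L₀] {M : ℝ} (hM : 0 ≤ M) :
    ∃ J₁ : ℝ, ∃ K : ℝ → ℝ, Tendsto K atTop (𝓝 0) ∧ (∀ J, 0 ≤ K J) ∧
      ∀ JE JM : ℝ, J₁ < JE → 0 ≤ JM → JM ≤ M → ∀ n : ℕ, 1 ≤ n →
        expectation (d := d) (L₀ := L₀) (L := 2 * n + 2) (fundamentalRep (Fin 2)) JE JM
            (fun U => 1 - |halfTrace U 0|) ≤ K JE ∧
        ∀ B : Finset ((Fin d → ZMod (2 * n + 2)) × Fin d),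
          expectation (d := d) (L₀ := L₀) (L := 2 * n + 2) (fundamentalRep (Fin 2)) JE JM
            ((wallEvent B).indicator 1) ≤ K JE ^ B.card := by
  obtain ⟨J₀, K₀, hK₀, hK₀nn, h⟩ := electricPatternBounds_allExtents hd L₀
  have hρc := continuous_fundamentalRep (Fin 2)
  -- the magnetic-removal constant per spatial site: `c = 4 M L₀ #{i<j}`
  set Cd : ℝ := (Fintype.card {p : Fin d × Fin d // p.1 < p.2} : ℝ) with hCd
  set c : ℝ := 4 * M * (L₀ : ℝ) * Cd with hc
  have hc0 : 0 ≤ c := by rw [hc, hCd]; positivity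
  -- the rate `K = e^{c} K₀` (also `≥ K₀`), and a threshold beyond which `K < 1`
  set K : ℝ → ℝ := fun J => Real.exp c * K₀ J with hK
  have hKt : Tendsto K atTop (𝓝 0) := by simpa [hK] using hK₀.const_mul (Real.exp c)
  have hKnn : ∀ J, 0 ≤ K J := fun J => mul_nonneg (Real.exp_pos _).le (hK₀nn J)
  obtain ⟨J₂, hJ₂⟩ := eventually_atTop.1 (hKt.eventually (gt_mem_nhds (by norm_num : (0:ℝ) < 1)))
  refine ⟨max J₀ (max J₂ 0), K, hKt, hKnn, fun JE JM hJE hJM hJMM n hn => ?_⟩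
  have hJE0 : J₀ < JE := lt_of_le_of_lt (le_max_left _ _) hJE
  have hJE2 : J₂ ≤ JE := ((le_max_left _ _).trans (le_max_right J₀ _)).trans hJE.le
  have hJEpos : 0 ≤ JE := (((le_max_right _ _).trans (le_max_right J₀ _)).trans hJE.le)
  have hK1 : K JE ≤ 1 := (hJ₂ JE hJE2).le
  have hK0 : 0 ≤ K JE := hKnn JE
  obtain ⟨hpt, hwall⟩ := h JE hJE0 (2 * n + 2)
  -- the magnetic-removal factor in the box `L = 2n+2`
  have hMfac : (2 : ℝ) * JM * (2 * (Fintype.card (FiniteTemperature.Site d L₀ (2 * n + 2)) *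
      Fintype.card {p : Fin d × Fin d // p.1 < p.2})) ≤ c * ((2 * n + 2 : ℕ) : ℝ) ^ d := by
    rw [card_site₀, hc, hCd]
    push_cast
    have h1 : (0 : ℝ) ≤ (L₀ : ℝ) * ((2 * n + 2 : ℝ) ^ d) * (Fintype.card {p : Fin d × Fin d // p.1 < p.2} : ℝ) := by
      positivity
    nlinarith
  have hfac : ∀ F : Config d L₀ (2 * n + 2) SU2 → ℝ, AEStronglyMeasurable F (haar d L₀ (2 * n + 2) SU2) →
      (∀ U, |F U| ≤ 1) → (∀ U, 0 ≤ F U) →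
      expectation (fundamentalRep (Fin 2)) JE JM F ≤
        Real.exp (c * ((2 * n + 2 : ℕ) : ℝ) ^ d) * expectation (fundamentalRep (Fin 2)) JE 0 F := by
    intro F hFm hFb hF0
    have h1 := expectation_le_exp_mul_expectation_electric (d := d) (L₀ := L₀) (L := 2 * n + 2)
      (fundamentalRep (Fin 2)) fundamentalRep_mem_unitaryGroup hρc (JE := JE) hJM hFm hFb hF0
    rw [Nat.cast_ofNat] at h1
    refine h1.trans (mul_le_mul_of_nonneg_right (Real.exp_le_exp.2 hMfac) ?_)
    -- `⟨F⟩_{J_E,0} ≥ 0`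
    have hZ := partitionFunction_pos (d := d) (L₀ := L₀) (L := 2 * n + 2) (fundamentalRep (Fin 2)) hρc JE 0
    unfold expectation
    exact div_nonneg (integral_nonneg fun U => mul_nonneg (hF0 U) (weight_pos _ _ _ U).le) hZ.le
  have hexp_pow : ∀ k : ℕ, Real.exp (c * k) = Real.exp c ^ k := fun k => by
    rw [mul_comm, Real.exp_nat_mul]
  -- the two PATTERN bounds at `(J_E, J_M)` with rate `K`
  have hpt' : expectation (fundamentalRep (Fin 2)) JE JM
      (fun U : Config d L₀ (2 * n + 2) SU2 => ∏ x, (1 - |halfTrace U x|)) ≤ K JE ^ (2 * n + 2) ^ d := by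
    have hFm : AEStronglyMeasurable (fun U : Config d L₀ (2 * n + 2) SU2 => ∏ x, (1 - |halfTrace U x|))
        (haar d L₀ (2 * n + 2) SU2) :=
      (continuous_finsetProd _ fun x _ => continuous_const.sub (continuous_halfTrace₀ x).abs).aestronglyMeasurable
    have hF01 : ∀ U : Config d L₀ (2 * n + 2) SU2,
        0 ≤ ∏ x, (1 - |halfTrace U x|) ∧ ∏ x, (1 - |halfTrace U x|) ≤ 1 := fun U =>
      ⟨Finset.prod_nonneg fun x _ => by have := abs_halfTrace_le_one U x; linarith,
        Finset.prod_le_one (fun x _ => by have := abs_halfTrace_le_one U x; linarith)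
          fun x _ => by have := abs_nonneg (halfTrace U x); linarith⟩
    refine (hfac _ hFm (fun U => abs_le.2 ⟨(neg_nonpos.2 zero_le_one).trans (hF01 U).1, (hF01 U).2⟩)
      (fun U => (hF01 U).1)).trans ?_
    calc Real.exp (c * ((2 * n + 2 : ℕ) : ℝ) ^ d) * expectation (fundamentalRep (Fin 2)) JE 0
            (fun U : Config d L₀ (2 * n + 2) SU2 => ∏ x, (1 - |halfTrace U x|))
        ≤ Real.exp (c * ((2 * n + 2 : ℕ) : ℝ) ^ d) * K₀ JE ^ (2 * n + 2) ^ d :=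
          mul_le_mul_of_nonneg_left hpt (Real.exp_pos _).le
      _ = (Real.exp c * K₀ JE) ^ (2 * n + 2) ^ d := by
          rw [mul_pow, ← hexp_pow]; push_cast; ring_nf
  have hwall' : ∀ i : Fin d, expectation (fundamentalRep (Fin 2)) JE JM
      ((wallEvent (d := d) (L₀ := L₀) (L := 2 * n + 2)
        ((Finset.univ : Finset (Fin d → ZMod (2 * n + 2))) ×ˢ {i})).indicator 1) ≤ K JE ^ (d * (2 * n + 2) ^ d) := by
    intro i
    have hE := measurableSet_wallEvent₀ (d := d) (L₀ := L₀) (L := 2 * n + 2)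
      ((Finset.univ : Finset (Fin d → ZMod (2 * n + 2))) ×ˢ {i})
    have hFm := (aestronglyMeasurable_indicator_iff (μ := haar d L₀ (2 * n + 2) SU2) hE).2
      (aestronglyMeasurable_const (b := (1 : ℝ)))
    have hF01 : ∀ U : Config d L₀ (2 * n + 2) SU2,
        0 ≤ (wallEvent ((Finset.univ : Finset (Fin d → ZMod (2 * n + 2))) ×ˢ {i})).indicator
            (1 : Config d L₀ (2 * n + 2) SU2 → ℝ) U ∧
        (wallEvent ((Finset.univ : Finset (Fin d → ZMod (2 * n + 2))) ×ˢ {i})).indicator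
            (1 : Config d L₀ (2 * n + 2) SU2 → ℝ) U ≤ 1 := fun U => by
      by_cases hU : U ∈ wallEvent ((Finset.univ : Finset (Fin d → ZMod (2 * n + 2))) ×ˢ {i})
      · rw [Set.indicator_of_mem hU]; simp
      · rw [Set.indicator_of_notMem hU]; simp
    refine (hfac _ hFm (fun U => abs_le.2 ⟨(neg_nonpos.2 zero_le_one).trans (hF01 U).1, (hF01 U).2⟩)
      (fun U => (hF01 U).1)).trans ?_
    have hd1 : (1 : ℝ) ≤ d := by exact_mod_cast (show 1 ≤ d by omega)
    calc Real.exp (c * ((2 * n + 2 : ℕ) : ℝ) ^ d) * expectation (fundamentalRep (Fin 2)) JE 0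
            ((wallEvent ((Finset.univ : Finset (Fin d → ZMod (2 * n + 2))) ×ˢ {i})).indicator 1)
        ≤ Real.exp (c * ((2 * n + 2 : ℕ) : ℝ) ^ d) * K₀ JE ^ (d * (2 * n + 2) ^ d) :=
          mul_le_mul_of_nonneg_left (hwall i) (Real.exp_pos _).le
      _ ≤ Real.exp (c * (d * (2 * n + 2) ^ d : ℕ)) * K₀ JE ^ (d * (2 * n + 2) ^ d) := by
          refine mul_le_mul_of_nonneg_right (Real.exp_le_exp.2 ?_) (pow_nonneg (hK₀nn _) _)
          push_cast
          have : 0 ≤ c * ((2 * n + 2 : ℕ) : ℝ) ^ d := by positivity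
          push_cast at this
          nlinarith
      _ = (Real.exp c * K₀ JE) ^ (d * (2 * n + 2) ^ d) := by
          rw [mul_pow, ← hexp_pow]
  -- the chessboard roots on the even torus `L_s = 2n+2`
  constructor
  · exact expectation_pointDefect_le_of_patternBound (n := n) rfl hJEpos hJM hK0 hpt' 0
  · intro B
    exact expectation_wallEvent_le_of_patternBound (n := n) hn rfl hJEpos hJM hK0 hK1 hwall' B

end Disorder

/-! ### §3. Theorems I and II at every temporal extent, in every even box (region form) -/

section Theorems

variable {d : ℕ}

/-- `4ρ/(1-ρ)² ≤ 16ρ` for `0 ≤ ρ ≤ 1/2`. [folklore] -/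
private theorem geom_bound_le₀ {ρ : ℝ} (h0 : 0 ≤ ρ) (h : ρ ≤ 1 / 2) : 4 * ρ / (1 - ρ) ^ 2 ≤ 16 * ρ := by
  rw [div_le_iff₀ (by nlinarith)]
  have h1 : 1 / 4 ≤ (1 - ρ) ^ 2 := by nlinarith
  calc 4 * ρ = 16 * ρ * (1 / 4) := by ring
    _ ≤ 16 * ρ * (1 - ρ) ^ 2 := mul_le_mul_of_nonneg_left h1 (by positivity)

/-- ★★ **Theorem I of Tomboulis–Yaffe at every temporal extent `L₀ ≥ 1` and in every even spatial box `L_s = 2n+2 ≥ 4`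
(region form)**: for `SU(2)`, `d ≥ 2`, `M ≥ 0` there are `J₁(d, L₀, M)` and `μ(J_E) → 0` with
`G_{L_s}(x) = ⟨tr Ω[0] tr Ω[x]⟩ ≥ 4e^{−μ(J_E)}` for all `J_E > J₁`, `0 ≤ J_M ≤ M`, all `n ≥ 1` and all `x` — the quark
free energy `F^{qq̄}(0,x)/T ≤ μ` uniformly in the volume and the separation.  Printed for `L_t = 2^a`, `L_s = 2^k` on the
hyperbola `(γθ, γ/θ)` (`PolyakovTwoPointLowerBound_holds`); same proof: `disorderBounds_allExtents` and the Peierls bound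
`polyakovCorrelation_ge_of_disorderBounds`. [cite: TomboulisYaffe1985, §III Theorem I (p. 320) and its corollary (p. 321); §III.A (3.2), §III.B (3.4)–(3.8) (pp. 321–323)] -/
theorem polyakovCorrelation_ge_allExtents (hd : 2 ≤ d) (L₀ : ℕ) [NeZero L₀] {M : ℝ} (hM : 0 ≤ M) :
    ∃ J₁ : ℝ, ∃ μ : ℝ → ℝ, Tendsto μ atTop (𝓝 0) ∧
      ∀ JE JM : ℝ, J₁ < JE → 0 ≤ JM → JM ≤ M → ∀ n : ℕ, 1 ≤ n → ∀ x : Fin d → ZMod (2 * n + 2),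
        4 * Real.exp (-μ JE) ≤
          polyakovCorrelation (d := d) (L₀ := L₀) (L := 2 * n + 2) (fundamentalRep (Fin 2)) JE JM x := by
  obtain ⟨J₁, K, hK, hKnn, h⟩ := disorderBounds_allExtents hd L₀ hM
  -- the constant of the final bound and the smallness threshold
  set C : ℝ := 2 + 128 * 19 ^ 6 * d with hC
  have hCpos : 0 < C := by rw [hC]; positivity
  set δ : ℝ := 1 / (2 * C) with hδ
  have hδpos : 0 < δ := by rw [hδ]; positivity
  obtain ⟨J₂, hJ₂⟩ := eventually_atTop.1 (hK.eventually (gt_mem_nhds hδpos))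
  -- `μ(J) = -log (1 - min (max (C K(J)) 0) (1/2))`
  set m : ℝ → ℝ := fun J => min (max (C * K J) 0) (1 / 2) with hm
  refine ⟨max J₁ J₂, fun J => -Real.log (1 - m J), ?_, fun JE JM hJE hJM hJMM n hn x => ?_⟩
  · -- `μ → 0`
    have hmt : Tendsto m atTop (𝓝 (min (max (C * 0) 0) (1 / 2))) :=
      ((hK.const_mul C).max tendsto_const_nhds).min tendsto_const_nhds
    rw [mul_zero, max_self, min_eq_left (by norm_num : (0:ℝ) ≤ 1 / 2)] at hmt
    have h1 : Tendsto (fun J => 1 - m J) atTop (𝓝 (1 - 0)) := tendsto_const_nhds.sub hmt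
    rw [sub_zero] at h1
    have h2 : Tendsto (fun J => Real.log (1 - m J)) atTop (𝓝 (Real.log 1)) :=
      (Real.continuousAt_log one_ne_zero).tendsto.comp h1
    rw [Real.log_one] at h2
    simpa using h2.neg
  · -- the bound above the threshold
    have hJE1 : J₁ < JE := lt_of_le_of_lt (le_max_left _ _) hJE
    have hJE2 : J₂ ≤ JE := (le_max_right _ _).trans hJE.le
    obtain ⟨hpt, hB⟩ := h JE JM hJE1 hJM hJMM n hn
    have hKδ : K JE < δ := hJ₂ JE hJE2
    have hK0 : 0 ≤ K JE := hKnn JE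
    have hCK : C * K JE ≤ 1 / 2 := by
      have : C * K JE ≤ C * δ := mul_le_mul_of_nonneg_left hKδ.le hCpos.le
      rw [hδ] at this
      calc C * K JE ≤ C * (1 / (2 * C)) := this
        _ = 1 / 2 := by field_simp
    have hCK0 : 0 ≤ C * K JE := mul_nonneg hCpos.le hK0
    have hmJ : m JE = C * K JE := by
      rw [hm]; simp only
      rw [max_eq_left hCK0, min_eq_left hCK]
    -- `ρ = 4·19⁶ K ≤ 1/2`
    have hρhalf : 4 * 19 ^ 6 * K JE ≤ 1 / 2 := by
      have h19 : (4 * 19 ^ 6 : ℝ) ≤ C := by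
        rw [hC]
        have : (2:ℝ) ≤ d := by exact_mod_cast hd
        nlinarith
      nlinarith
    have hρ1 : 4 * 19 ^ 6 * K JE < 1 := by linarith
    have hL : 2 < 2 * n + 2 := by omega
    have hmain := polyakovCorrelation_ge_of_disorderBounds (L₀ := L₀) hd hL hK0 hρ1 hpt hB x
    -- compare the explicit bound with `4 e^{-μ} = 4 (1 - C K)`
    have hgeom := geom_bound_le₀ (by positivity : (0:ℝ) ≤ 4 * 19 ^ 6 * K JE) hρhalf
    have hexp : Real.exp (-(-Real.log (1 - m JE))) = 1 - C * K JE := by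
      rw [neg_neg, hmJ, Real.exp_log (by linarith)]
    rw [hexp]
    refine le_trans ?_ hmain
    have hd0 : (0:ℝ) ≤ d := Nat.cast_nonneg d
    have : (d : ℝ) * (4 * (4 * 19 ^ 6 * K JE) / (1 - 4 * 19 ^ 6 * K JE) ^ 2) ≤ d * (16 * (4 * 19 ^ 6 * K JE)) :=
      mul_le_mul_of_nonneg_left hgeom hd0
    rw [hC]
    nlinarith

/-- ★★ **Theorem II of Tomboulis–Yaffe at every temporal extent `L₀ ≥ 1` and in every even spatial box
`L_s = 2n+2 ≥ 4` (region form), for every stack direction `i`**: for `SU(2)`, `d ≥ 2`, `M ≥ 0` there is `J₁(d, L₀, M)`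
with `exp(−F^{mag}_{0i}/T) = ⟨∏_{p ∈ S_{0i}} e^{−2J_E Re tr U[∂p]}⟩ ≤ ½` (so `exp(−F^{elec}_{0i}/T) ≥ ¼`,
`electricFluxExp_ge_quarter_allExtents`) for all `J_E > J₁`, `0 ≤ J_M ≤ M` and all `n ≥ 1`.  Printed for `L_t = 2^a`,
`L_s = 2^k`, `i = 1`, on the hyperbola (`MagneticFluxFreeEnergyBound_holds`); same proof: `disorderBounds_allExtents` and
`magneticFluxExp_le_of_disorderBounds` ((3.3): link flip, reflection positivity in the site planes `⊥ e_i`, Peierls).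
[cite: TomboulisYaffe1985, §III Theorem II (p. 320) and its equivalent form (p. 321); §III.A (3.3) (pp. 321–322); §III.B (3.8) (p. 323)] -/
theorem magneticFluxExp_le_half_allExtents (hd : 2 ≤ d) (L₀ : ℕ) [NeZero L₀] {M : ℝ} (hM : 0 ≤ M) :
    ∃ J₁ : ℝ, ∀ JE JM : ℝ, J₁ < JE → 0 ≤ JM → JM ≤ M → ∀ n : ℕ, 1 ≤ n → ∀ i : Fin d,
      magneticFluxExp (d := d) (L₀ := L₀) (L := 2 * n + 2) (fundamentalRep (Fin 2)) JE JM i ≤ 1 / 2 := by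
  obtain ⟨J₁, K, hK, hKnn, h⟩ := disorderBounds_allExtents hd L₀ hM
  -- smallness threshold
  set δ : ℝ := min (1 / (256 * (64 * 19 ^ 6 * d))) (1 / 128) with hδ
  have hd0 : (0 : ℝ) < d := by exact_mod_cast (show 0 < d by omega)
  have hδpos : 0 < δ := by rw [hδ]; positivity
  obtain ⟨J₂, hJ₂⟩ := eventually_atTop.1 (hK.eventually (gt_mem_nhds hδpos))
  refine ⟨max J₁ J₂, fun JE JM hJE hJM hJMM n hn i => ?_⟩
  have hJE1 : J₁ < JE := lt_of_le_of_lt (le_max_left _ _) hJE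
  have hJE2 : J₂ ≤ JE := (le_max_right _ _).trans hJE.le
  obtain ⟨hpt, hB⟩ := h JE JM hJE1 hJM hJMM n hn
  have hKδ : K JE < δ := hJ₂ JE hJE2
  have hK0 : 0 ≤ K JE := hKnn JE
  have hK1 : K JE ≤ 1 / (256 * (64 * 19 ^ 6 * d)) := hKδ.le.trans (min_le_left _ _)
  have hK2 : K JE ≤ 1 / 128 := hKδ.le.trans (min_le_right _ _)
  -- `ρ ≤ 1/2`
  have hρhalf : 4 * 19 ^ 6 * K JE ≤ 1 / 2 := by
    have h1 : 4 * 19 ^ 6 * K JE ≤ 4 * 19 ^ 6 * (1 / (256 * (64 * 19 ^ 6 * d))) :=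
      mul_le_mul_of_nonneg_left hK1 (by positivity)
    have h2 : (4 : ℝ) * 19 ^ 6 * (1 / (256 * (64 * 19 ^ 6 * d))) = 1 / (4096 * d) := by
      field_simp; ring
    have hd2 : (2 : ℝ) ≤ d := by exact_mod_cast hd
    have h3 : (1 : ℝ) / (4096 * d) ≤ 1 / 2 :=
      one_div_le_one_div_of_le (by norm_num) (by linarith)
    linarith
  have hρ1 : 4 * 19 ^ 6 * K JE < 1 := by linarith
  have hbox := magneticFluxExp_le_of_disorderBounds (L₀ := L₀) (n := n) hd hn (L := 2 * n + 2) rfl hK0 hρ1 hpt hB i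
  refine hbox.trans ?_
  -- `4 √P + 2 √(2K) ≤ 1/2`
  have hgeom := geom_bound_le₀ (by positivity : (0:ℝ) ≤ 4 * 19 ^ 6 * K JE) hρhalf
  have hP : (d : ℝ) * (4 * (4 * 19 ^ 6 * K JE) / (1 - 4 * 19 ^ 6 * K JE) ^ 2) ≤ (1 / 16) ^ 2 := by
    calc (d : ℝ) * (4 * (4 * 19 ^ 6 * K JE) / (1 - 4 * 19 ^ 6 * K JE) ^ 2)
        ≤ d * (16 * (4 * 19 ^ 6 * K JE)) := mul_le_mul_of_nonneg_left hgeom hd0.le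
      _ = (64 * 19 ^ 6 * d) * K JE := by ring
      _ ≤ (64 * 19 ^ 6 * d) * (1 / (256 * (64 * 19 ^ 6 * d))) := mul_le_mul_of_nonneg_left hK1 (by positivity)
      _ = (1 / 16) ^ 2 := by field_simp; ring
  have h1 : Real.sqrt ((d : ℝ) * (4 * (4 * 19 ^ 6 * K JE) / (1 - 4 * 19 ^ 6 * K JE) ^ 2)) ≤ 1 / 16 :=
    Real.sqrt_le_iff.2 ⟨by norm_num, hP⟩
  have h2 : Real.sqrt (2 * K JE) ≤ 1 / 8 :=
    Real.sqrt_le_iff.2 ⟨by norm_num, by nlinarith⟩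
  linarith

/-- **`exp(−F^{elec}_{0i}/T) ≥ ¼` at every temporal extent, every even box, every stack direction** (Theorem II with
(2.9) `exp(−F^{elec}/T) = ½(1 − exp(−F^{mag}/T))`): the electric-flux free energy stays bounded as `L_s → ∞`.
[cite: TomboulisYaffe1985, §III Theorem II (p. 320); §II.A (2.9) (p. 317)] -/
theorem electricFluxExp_ge_quarter_allExtents (hd : 2 ≤ d) (L₀ : ℕ) [NeZero L₀] {M : ℝ} (hM : 0 ≤ M) :
    ∃ J₁ : ℝ, ∀ JE JM : ℝ, J₁ < JE → 0 ≤ JM → JM ≤ M → ∀ n : ℕ, 1 ≤ n → ∀ i : Fin d,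
      1 / 4 ≤ electricFluxExp (d := d) (L₀ := L₀) (L := 2 * n + 2) (fundamentalRep (Fin 2)) JE JM i := by
  obtain ⟨J₁, h⟩ := magneticFluxExp_le_half_allExtents hd L₀ hM
  refine ⟨J₁, fun JE JM hJE hJM hJMM n hn i => ?_⟩
  have := h JE JM hJE hJM hJMM n hn i
  unfold electricFluxExp
  linarith

/-! ### §4. The printed hyperbola forms `(J_E, J_M) = (γθ, γ/θ)` at every `L₀` and every even `L_s` -/

/-- Along the hyperbola `(γθ, γ/θ)`, `γ > 0`: above `θ₀ = max(J₁/γ, 1)` one has `J_E = γθ > J₁` and `0 ≤ J_M = γ/θ ≤ γ`.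
[cite: TomboulisYaffe1985, §II.A (2.2)–(2.3) (p. 315)] -/
private theorem hyperbola_mem_region {γ J₁ θ : ℝ} (hγ : 0 < γ) (hθ : max (J₁ / γ) 1 < θ) :
    J₁ < γ * θ ∧ 0 ≤ γ / θ ∧ γ / θ ≤ γ := by
  have hθ1 : 1 ≤ θ := (le_max_right _ _).trans hθ.le
  have hθpos : 0 < θ := lt_of_lt_of_le one_pos hθ1
  refine ⟨?_, (div_pos hγ hθpos).le, ?_⟩
  · have := lt_of_le_of_lt (le_max_left _ _) hθ
    rw [div_lt_iff₀ hγ] at this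
    linarith [mul_comm θ γ]
  · rw [div_le_iff₀ hθpos]
    nlinarith

/-- **Theorem I on the printed hyperbola, at every temporal extent `L₀ ≥ 1` and in every even box `L_s = 2n+2 ≥ 4`**:
for `γ > 0`, `d ≥ 2` there are `θ₀` and `μ(θ) → 0` (`θ ∝ T → ∞`) with `G_{L_s}(x) ≥ 4e^{−μ(θ)}` at couplings
`(γθ, γ/θ)` for all `θ > θ₀`, `n ≥ 1`, `x`.  (`PolyakovTwoPointLowerBound_holds` is the sub-case `L₀ = 2^a`,
`L_s = 2^k = 2(2^{k−1} − 1) + 2`.) [cite: TomboulisYaffe1985, §III Theorem I (p. 320) and its corollary (p. 321)] -/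
theorem polyakovCorrelation_ge_hyperbola {γ : ℝ} (hγ : 0 < γ) (hd : 2 ≤ d) (L₀ : ℕ) [NeZero L₀] :
    ∃ θ₀ : ℝ, ∃ μ : ℝ → ℝ, Tendsto μ atTop (𝓝 0) ∧
      ∀ θ : ℝ, θ₀ < θ → ∀ n : ℕ, 1 ≤ n → ∀ x : Fin d → ZMod (2 * n + 2),
        4 * Real.exp (-μ θ) ≤
          polyakovCorrelation (d := d) (L₀ := L₀) (L := 2 * n + 2) (fundamentalRep (Fin 2)) (γ * θ) (γ / θ) x := by
  obtain ⟨J₁, μ, hμ, h⟩ := polyakovCorrelation_ge_allExtents hd L₀ hγ.le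
  refine ⟨max (J₁ / γ) 1, fun θ => μ (γ * θ), ?_, fun θ hθ n hn x => ?_⟩
  · exact hμ.comp (tendsto_id.const_mul_atTop hγ)
  · obtain ⟨h1, h2, h3⟩ := hyperbola_mem_region hγ hθ
    exact h _ _ h1 h2 h3 n hn x

/-- **Theorem II on the printed hyperbola, at every temporal extent `L₀ ≥ 1`, in every even box `L_s = 2n+2 ≥ 4`, for
every stack direction `i`**: for `γ > 0`, `d ≥ 2` there is `θ₀` with `exp(−F^{mag}_{0i}/T) ≤ ½` at couplings
`(γθ, γ/θ)` for all `θ > θ₀` and all `n ≥ 1`.  (`MagneticFluxFreeEnergyBound_holds` is the sub-case `L₀ = 2^a`,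
`L_s = 2^k`, `i = ⟨0, _⟩`, `ε = ¼`.) [cite: TomboulisYaffe1985, §III Theorem II (p. 320) and its equivalent form (p. 321)] -/
theorem magneticFluxExp_le_half_hyperbola {γ : ℝ} (hγ : 0 < γ) (hd : 2 ≤ d) (L₀ : ℕ) [NeZero L₀] :
    ∃ θ₀ : ℝ, ∀ θ : ℝ, θ₀ < θ → ∀ n : ℕ, 1 ≤ n → ∀ i : Fin d,
      magneticFluxExp (d := d) (L₀ := L₀) (L := 2 * n + 2) (fundamentalRep (Fin 2)) (γ * θ) (γ / θ) i ≤ 1 / 2 := by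
  obtain ⟨J₁, h⟩ := magneticFluxExp_le_half_allExtents hd L₀ hγ.le
  refine ⟨max (J₁ / γ) 1, fun θ hθ n hn i => ?_⟩
  obtain ⟨h1, h2, h3⟩ := hyperbola_mem_region hγ hθ
  exact h _ _ h1 h2 h3 n hn i

end Theorems

/-! ### §5. ★ Polyakov long-range order for `SU(2)` in every `d ≥ 2` at every temporal extent -/

section LongRangeOrder

variable {d : ℕ}

/-- `ℤ^d` is infinite for `d ≥ 1`, so its cofinite filter is non-trivial. [folklore] -/
private theorem cofinite_neBot_pi₀ (hd : 0 < d) : (cofinite : Filter (Fin d → ℤ)).NeBot := by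
  haveI : Infinite (Fin d → ℤ) :=
    Infinite.of_injective (fun n : ℤ => fun _ : Fin d => n) fun a b hab => congr_fun hab ⟨0, hd⟩
  infer_instance

/-- ★★★ **Polyakov long-range order for `SU(2)` at high temperature, in EVERY `d ≥ 2`, at EVERY temporal extent
`L₀ ≥ 1`** — the positive notion `HasPolyakovLongRangeOrder` of the barrier `FiniteTemperatureDeconfinement`: for
`M ≥ 0` there is `J₁(d, L₀, M)` such that for all `J_E > J₁` and `0 ≤ J_M ≤ M` EVERY subsequential thermodynamic limit
`G∞` of the Polyakov two-point function (along even boxes) satisfies `G∞(x) ≥ 4e^{−μ(J_E)} > 0` for all `x`, hence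
`G∞ ↛ 0` ("long range order of `G` clearly means absence of confinement").  Theorem I in every even box
(`polyakovCorrelation_ge_allExtents`) passed to the limit.  In `d = 2` (`2+1` dimensions) this is not covered by the
tree's Borgs–Seiler theorem `FiniteTemperatureDeconfinement_holds` (`d ≥ 3`).
[cite: TomboulisYaffe1985, §III Theorem I (p. 320), §I result A (p. 313)] [cite: BorgsSeiler1983, §II.3 (II.23) (p. 337)] -/
theorem hasPolyakovLongRangeOrder_su2 (hd : 2 ≤ d) (L₀ : ℕ) [NeZero L₀] {M : ℝ} (hM : 0 ≤ M) :
    ∃ J₁ : ℝ, ∃ μ : ℝ → ℝ, Tendsto μ atTop (𝓝 0) ∧ ∀ JE JM : ℝ, J₁ < JE → 0 ≤ JM → JM ≤ M →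
      HasPolyakovLongRangeOrder d L₀ (fundamentalRep (Fin 2)) JE JM ∧
      ∀ Ginf : (Fin d → ℤ) → ℝ, IsThermodynamicLimit (d := d) (L₀ := L₀) (fundamentalRep (Fin 2)) JE JM Ginf →
        ∀ x, 4 * Real.exp (-μ JE) ≤ Ginf x := by
  obtain ⟨J₁, μ, hμ, h⟩ := polyakovCorrelation_ge_allExtents hd L₀ hM
  refine ⟨J₁, μ, hμ, fun JE JM hJE hJM hJMM => ?_⟩
  -- every thermodynamic limit is `≥ 4e^{-μ}` pointwise
  have hlow : ∀ Ginf : (Fin d → ℤ) → ℝ,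
      IsThermodynamicLimit (d := d) (L₀ := L₀) (fundamentalRep (Fin 2)) JE JM Ginf →
        ∀ x, 4 * Real.exp (-μ JE) ≤ Ginf x := by
    rintro Ginf ⟨φ, hφ, hlim⟩ x
    refine ge_of_tendsto (hlim x) (eventually_atTop.2 ⟨1, fun k hk => ?_⟩)
    have hφk : 1 ≤ φ k := hk.trans hφ.le_apply
    exact h JE JM hJE hJM hJMM (φ k) hφk _
  refine ⟨fun Ginf hG hdecay => ?_, hlow⟩
  have hpos : 0 < 4 * Real.exp (-μ JE) := by positivity
  haveI := cofinite_neBot_pi₀ (d := d) (by omega)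
  obtain ⟨x, hx⟩ := (hdecay.eventually (gt_mem_nhds hpos)).exists
  exact absurd (hlow Ginf hG x) (not_le.2 hx)

/-- ★★★ **Polyakov long-range order for `SU(2)` along the printed high-temperature hyperbola, every `d ≥ 2`, every
`L₀ ≥ 1`**: for `γ > 0` there is `θ₀(γ, d, L₀)` with `HasPolyakovLongRangeOrder d L₀ (fundamentalRep (Fin 2)) (γθ) (γ/θ)`
for all `θ > θ₀` (`θ ∝ T`). [cite: TomboulisYaffe1985, §III Theorem I (p. 320), §I result A (p. 313)] [cite: BorgsSeiler1983, §II.3 (II.23) (p. 337)] -/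
theorem hasPolyakovLongRangeOrder_su2_hyperbola {γ : ℝ} (hγ : 0 < γ) (hd : 2 ≤ d) (L₀ : ℕ) [NeZero L₀] :
    ∃ θ₀ : ℝ, ∀ θ : ℝ, θ₀ < θ → HasPolyakovLongRangeOrder d L₀ (fundamentalRep (Fin 2)) (γ * θ) (γ / θ) := by
  obtain ⟨J₁, μ, -, h⟩ := hasPolyakovLongRangeOrder_su2 hd L₀ hγ.le
  refine ⟨max (J₁ / γ) 1, fun θ hθ => ?_⟩
  obtain ⟨h1, h2, h3⟩ := hyperbola_mem_region hγ hθ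
  exact (h _ _ h1 h2 h3).1

/-- **`2+1` dimensions**: Polyakov long-range order for `SU(2)` lattice gauge theory in `d = 2` space dimensions at
every temporal extent `L₀ ≥ 1` along the high-temperature hyperbola — the case NOT reached by the Borgs–Seiler
infrared-bound route (`FiniteTemperatureDeconfinement_holds`: `d ≥ 3`), and in contrast with `U(1)`, for which
Polyakov confinement holds at all couplings in `d = 2` (tree: `u1_temperatureBlindPolyakovConfinement_iff`).
[cite: TomboulisYaffe1985, §I result A "In two or more space dimensions" (p. 313); §III Theorem I (p. 320)] -/
theorem hasPolyakovLongRangeOrder_su2_twoPlusOne {γ : ℝ} (hγ : 0 < γ) (L₀ : ℕ) [NeZero L₀] :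
    ∃ θ₀ : ℝ, ∀ θ : ℝ, θ₀ < θ → HasPolyakovLongRangeOrder 2 L₀ (fundamentalRep (Fin 2)) (γ * θ) (γ / θ) :=
  hasPolyakovLongRangeOrder_su2_hyperbola hγ le_rfl L₀

/-! ### §6. The barrier's technique classes (i), (ii) fail for `SU(2)` in every `d ≥ 2` at EVERY temporal extent -/

/-- **Polyakov's confinement criterion fails for `SU(2)` in every `d ≥ 2` at EVERY temporal extent `L₀ ≥ 1`**: class
(i) `PolyakovConfinementAtAllCouplings d L₀ (fundamentalRep (Fin 2))` of the barrier `FiniteTemperatureDeconfinement` is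
refuted (tree: `not_polyakovConfinementAtAllCouplings_su2_holds` for `L₀ = 2^a`; Borgs–Seiler's
`not_polyakovConfinementAtAllCouplings_specialUnitary_holds` for `d ≥ 3`).
[cite: TomboulisYaffe1985, §III Theorem I (p. 320); §I result A (p. 313)] -/
theorem su2_not_polyakovConfinementAtAllCouplings (hd : 2 ≤ d) (L₀ : ℕ) [NeZero L₀] :
    ¬ PolyakovConfinementAtAllCouplings d L₀ (fundamentalRep (Fin 2)) := by
  intro hP
  obtain ⟨J₁, μ, -, h⟩ := hasPolyakovLongRangeOrder_su2 hd L₀ zero_le_one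
  set JE : ℝ := max J₁ 0 + 1 with hJEdef
  have hJE : J₁ < JE := by have := le_max_left J₁ 0; rw [hJEdef]; linarith
  have hJEpos : 0 < JE := by have := le_max_right J₁ 0; rw [hJEdef]; linarith
  obtain ⟨hLRO, -⟩ := h JE 1 hJE zero_le_one le_rfl
  obtain ⟨Ginf, hG⟩ := exists_isThermodynamicLimit (d := d) (L₀ := L₀) (fundamentalRep (Fin 2))
    (continuous_fundamentalRep (Fin 2)) fundamentalRep_mem_unitaryGroup JE 1
  exact hLRO Ginf hG (hP JE 1 hJEpos one_pos Ginf hG)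

/-- **No volume-uniform exponential clustering of Polyakov loops at all couplings for `SU(2)` in every `d ≥ 2` at
EVERY temporal extent `L₀ ≥ 1`**: class (ii) `UniformClusteringAtAllCouplings d L₀ (fundamentalRep (Fin 2))` of the
barrier is refuted (a uniform bound `|G_{2k+2}(x)| ≤ Ce^{−m‖x‖}` contradicts `G_{2k+2}((k+1)e₀) ≥ 4e^{−μ}` for large `k`;
tree: `not_uniformClusteringAtAllCouplings_su2_holds` for `L₀ = 2^a`). [cite: TomboulisYaffe1985, §III Theorem I (p. 320)] -/
theorem su2_not_uniformClusteringAtAllCouplings (hd : 2 ≤ d) (L₀ : ℕ) [NeZero L₀] :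
    ¬ UniformClusteringAtAllCouplings d L₀ (fundamentalRep (Fin 2)) := by
  intro hU
  obtain ⟨J₁, μ, -, h⟩ := polyakovCorrelation_ge_allExtents hd L₀ zero_le_one
  set JE : ℝ := max J₁ 0 + 1 with hJEdef
  have hJE : J₁ < JE := by have := le_max_left J₁ 0; rw [hJEdef]; linarith
  have hJEpos : 0 < JE := by have := le_max_right J₁ 0; rw [hJEdef]; linarith
  obtain ⟨C, m, hm, hb⟩ := hU JE 1 hJEpos one_pos
  have hd0 : 0 < d := by omega
  -- `4 e^{-μ} ≤ C e^{-m (k+1)}` for every `k ≥ 1`, testing at `x = (k+1) e₀`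
  have key : ∀ k : ℕ, 1 ≤ k → 4 * Real.exp (-μ JE) ≤ C * Real.exp (-(m * ((k : ℝ) + 1))) := by
    intro k hk
    set x : Fin d → ℤ := Pi.single (⟨0, hd0⟩ : Fin d) ((k : ℤ) + 1) with hxdef
    have hxdom : ∀ i, |x i| ≤ (k : ℤ) + 1 := by
      intro i
      rw [hxdef]
      by_cases hi : i = ⟨0, hd0⟩
      · subst hi
        rw [Pi.single_eq_same, abs_of_nonneg (by positivity)]
      · rw [Pi.single_eq_of_ne hi, abs_zero]
        positivity
    have hxnorm : ‖x‖ = (k : ℝ) + 1 := by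
      rw [hxdef, Pi.norm_single, Int.norm_eq_abs, abs_of_nonneg (by positivity)]
      push_cast
      ring
    have hup := hb k x hxdom
    rw [hxnorm, neg_mul] at hup
    have hlow := h JE 1 hJE zero_le_one le_rfl k hk (fun i => ((x i : ℤ) : ZMod (2 * k + 2)))
    exact hlow.trans ((le_abs_self _).trans hup)
  -- contradiction as `k → ∞`
  have h2 : Tendsto (fun k : ℕ => m * ((k : ℝ) + 1)) atTop atTop :=
    (tendsto_natCast_atTop_atTop.atTop_add tendsto_const_nhds).const_mul_atTop hm
  have hlim : Tendsto (fun k : ℕ => C * Real.exp (-(m * ((k : ℝ) + 1)))) atTop (𝓝 (C * 0)) :=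
    tendsto_const_nhds.mul (Real.tendsto_exp_atBot.comp (tendsto_neg_atTop_atBot.comp h2))
  rw [mul_zero] at hlim
  have hpos : 0 < 4 * Real.exp (-μ JE) := by positivity
  obtain ⟨k, hk⟩ := ((hlim.eventually (gt_mem_nhds hpos)).and (eventually_ge_atTop 1)).exists
  exact absurd (key k hk.2) (not_le.2 hk.1)

end LongRangeOrder

end

end Literature.MathematicalPhysics.QuantumFieldTheory.TomboulisYaffeHighTemperature
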